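import Summits.CriticalPhenomena.CardyFormulaZ2.Theorems.CardyFlipRussoVoronoiHubFromSmirnovVoidBall

/-!
# Stub `poisson_voidBall_unionBound_of_le_intensity` of line `moebius-exact-delaunay-dilation-ward`
# (crux `VoronoiHubFromSmirnov`, stmt-CriticalPhenomena-6433)

Void balls are rare for a planar Poisson process whose intensity `μ` dominates a positive
multiple `m₀ · Leb` of Lebesgue measure (the inhomogeneous version of the core union bound of
I. Benjamini, O. Schramm, *Conformal invariance of Voronoi percolation*, Comm. Math. Phys. 197
(1998) 75–107, Lemma 5.5 "no giant tiles"): if a set `A ⊆ ℂ` is covered by the balls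
`B(x, s/3)`, `x ∈ X` (`X` finite), then the probability that some point `z ∈ A` has no Poisson
nucleus within distance `< s` is at most `|X| · exp(-m₀ π (s/3)²)`.

Proof (identical to the Lebesgue version `poisson_voidBall_unionBound`).
* Inclusion `{c | ∃ z ∈ A, ∀ q ∈ c, s ≤ dist q z} ⊆ ⋃_{x ∈ X} {c | N_c(B(x, s/3)) = 0}`
  (`vb_voidSet_subset`).
* Monotonicity and the finite union bound for `Measure.real` (`measureReal_mono`,
  `measureReal_biUnion_finset_le`; `P` is a probability measure).
* Each term is the void probability `P(N(B(x, s/3)) = 0) = exp(-μ(B(x, s/3)))`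
  (`IsPoissonPointProcess.measureReal_count_eq_zero`), and
  `μ(B(x, s/3)) ≥ m₀ |B(x, s/3)| = m₀ π (s/3)²` by the domination hypothesis
  (`vb_volume_ball_toReal`), so each term is `≤ exp(-m₀ π (s/3)²)` (`Real.exp_le_exp`).

No new definitions; tree facts and Mathlib only.
-/

noncomputable section

namespace Summit.CriticalPhenomena.CardyFormulaZ2.Cruxes.VoronoiHubFromSmirnov.MoebiusExactDelaunayDilationWard

open MeasureTheory Literature.Analysis.FunctionSpaces
open scoped ENNReal NNReal

/-- Lower bound on the intensity of a disc: if `μ ≥ m₀ · Leb` on measurable sets (`m₀ > 0`) and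
`μ(B(x, r)) < ∞`, then `m₀ π r² ≤ μ(B(x, r))` as real numbers (`r ≥ 0`). -/
theorem vbi_le_measure_ball_toReal {μ : Measure ℂ} {m₀ : ℝ} (hm₀ : 0 < m₀)
    (hdom : ∀ S : Set ℂ, MeasurableSet S → ENNReal.ofReal m₀ * volume S ≤ μ S)
    (x : ℂ) {r : ℝ} (hr : 0 ≤ r) (hfin : μ (Metric.ball x r) ≠ ⊤) :
    m₀ * Real.pi * r ^ 2 ≤ (μ (Metric.ball x r)).toReal := by
  have h := ENNReal.toReal_mono hfin (hdom (Metric.ball x r) Metric.isOpen_ball.measurableSet)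
  rw [ENNReal.toReal_mul, ENNReal.toReal_ofReal hm₀.le, vb_volume_ball_toReal x hr] at h
  linarith

/-- Each void-ball probability is small: for a Poisson process `P` of intensity `μ ≥ m₀ · Leb`
(`m₀ > 0`) with `μ(B(x, r)) < ∞`, `P(N(B(x, r)) = 0) ≤ exp(-m₀ π r²)` (`r ≥ 0`). -/
theorem vbi_measureReal_void_ball_le {μ : Measure ℂ} {P : Measure (PointConfig ℂ)} {m₀ : ℝ}
    (hP : IsPoissonPointProcess μ P) (hm₀ : 0 < m₀)
    (hdom : ∀ S : Set ℂ, MeasurableSet S → ENNReal.ofReal m₀ * volume S ≤ μ S)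
    (x : ℂ) {r : ℝ} (hr : 0 ≤ r) (hfin : μ (Metric.ball x r) ≠ ⊤) :
    P.real {c : PointConfig ℂ | c.count (Metric.ball x r) = 0} ≤
      Real.exp (-(m₀ * Real.pi * r ^ 2)) := by
  rw [hP.measureReal_count_eq_zero Metric.isOpen_ball.measurableSet hfin]
  exact Real.exp_le_exp.2 (neg_le_neg (vbi_le_measure_ball_toReal hm₀ hdom x hr hfin))

/-- **Void balls are rare** for intensities dominating `m₀ · Leb` (Benjamini–Schramm 1998, core
of Lemma 5.5, inhomogeneous form): for a Poisson process `P` on `ℂ` of locally finite intensity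
`μ ≥ m₀ · Leb` (`m₀ > 0`), a finite set of centres `X` and `A ⊆ ⋃_{x ∈ X} B(x, s/3)` (`s > 0`),
the probability that some `z ∈ A` has all nuclei at distance `≥ s` is at most
`|X| · exp(-m₀ π (s/3)²)` (union bound over the void events of the balls `B(x, s/3)`). -/
theorem poisson_voidBall_unionBound_of_le_intensity : ∀ {μ : MeasureTheory.Measure ℂ} {P : MeasureTheory.Measure (Literature.Analysis.FunctionSpaces.PointConfig ℂ)} (m₀ : ℝ), Literature.Analysis.FunctionSpaces.IsPoissonPointProcess μ P → 0 < m₀ → (∀ S : Set ℂ, MeasurableSet S → ENNReal.ofReal m₀ * MeasureTheory.volume S ≤ μ S) → (∀ (x : ℂ) (r : ℝ), μ (Metric.ball x r) ≠ ⊤) → ∀ (A : Set ℂ) (X : Finset ℂ) (s : ℝ), 0 < s → A ⊆ ⋃ x ∈ X, Metric.ball x (s / 3) → P.real {c | ∃ z ∈ A, ∀ q ∈ c, s ≤ dist q z} ≤ X.card * Real.exp (-(m₀ * Real.pi * (s / 3) ^ 2)) := by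
  intro μ P m₀ hP hm₀ hdom hfin A X s hs hAX
  haveI := hP.isProbabilityMeasure
  calc P.real {c | ∃ z ∈ A, ∀ q ∈ c, s ≤ dist q z}
      ≤ P.real (⋃ x ∈ X, {c : PointConfig ℂ | c.count (Metric.ball x (s / 3)) = 0}) :=
        measureReal_mono (vb_voidSet_subset A X s hAX) (measure_ne_top _ _)
    _ ≤ ∑ x ∈ X, P.real {c : PointConfig ℂ | c.count (Metric.ball x (s / 3)) = 0} :=
        measureReal_biUnion_finset_le _ _
    _ ≤ ∑ _x ∈ X, Real.exp (-(m₀ * Real.pi * (s / 3) ^ 2)) :=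
        Finset.sum_le_sum fun x _ =>
          vbi_measureReal_void_ball_le hP hm₀ hdom x (by positivity : (0 : ℝ) ≤ s / 3)
            (hfin x (s / 3))
    _ = X.card * Real.exp (-(m₀ * Real.pi * (s / 3) ^ 2)) := by
        rw [Finset.sum_const, nsmul_eq_mul]

end Summit.CriticalPhenomena.CardyFormulaZ2.Cruxes.VoronoiHubFromSmirnov.MoebiusExactDelaunayDilationWard

end
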